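import Summits.HodgeConjecture.CorCM.GaloisQuaternionCompositum
import HarnessLib

/-!
# Halves for the two-fibre criterion: `Q₈`, `D₄`, `C₈` — so `Q_{4n}`-CM fields die under totally real octic
# Galois factors with these groups (`Q₈ × Q_{4n}`, `D₄ × Q_{4n}`, `C₈ × Q_{4n}` are BAD)

COR-CM (cell `pub-hodgecm2`), binder seat b04 (gen 23), count-neutral claim CYCLIC-BY-MULTIPLIERS, part XIII (blanket
NAME ACK `CorCM/GaloisQuaternion*`, HOME/INBOX l.9747).  HC_CM is NOT proved here; unconditional negative-side
examples.

Part XII (`exists_simple_degenerate_of_quaternion_compositum`) needs, in the Galois group `H` of the totally real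
factor, a HALF `A` (`2|A| = |H|`) that is APERIODIC (`aA = A ⟹ a = 1`) and NOWHERE SELF-COMPLEMENTARY (`aA ≠ H ∖ A`).
This file records such halves for the three non-elementary-abelian groups of order `8` — `{1, a, a², x} ⊂ Q₈`,
`{1, r, s, sr²} ⊂ D₄`, `{0, 1, 2, 4} ⊂ ℤ/8` (all by `decide`; the seat's enumeration `scratch/g23i.py` counts `24`, `8`,
`24` such halves containing `1`, `6` in `ℤ/6`, `110` in `ℤ/10`, and NONE in `C₂³` — the elementary abelian groups
need the coset-adapted level functions of part XI instead) — and the resulting BAD verdicts for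
`Gal(K/ℚ) ≅ Q₈ × Q_{4n}`, `D₄ × Q_{4n}`, `C₈ × Q_{4n}` with complex conjugation `(1, aⁿ)` (a totally real octic
Galois field times a `Q_{4n}`-CM field; dimension `16n`; order `64` for `n = 2`, beyond the order-32 census).

References: Shimura (1998), §6.2 Thm. 3, §8.2 Prop. 26 [cite: Shimura1998]; Gordon (1999), Thm. 6.4, §9
[cite: Gordon1999HodgeAVSurvey].
-/

noncomputable section

open CategoryTheory CategoryTheory.Limits NumberField
open scoped BigOperators

namespace Summit.HodgeConjecture.CorCM.GaloisModels

open Literature.NumberTheory.ComplexMultiplication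
open Literature.AlgebraicGeometry.Motives (AbelianVariety CMType)
open Literature.AlgebraicGeometry.HodgeTheory
open Literature.AlgebraicGeometry.ComplexMultiplication (IsCMTypeRealisation)
open Literature.AlgebraicGeometry.Pohlmann1968
open Literature.Barriers.HodgeConjecture (divisorClassesSpan)

section Halves

open QuaternionGroup DihedralGroup

/-- `{1, a, a², x} ⊂ Q₈` is a balanced, aperiodic, nowhere self-complementary half. [folklore] -/
theorem quaternionTwo_half :
    2 * ({a 0, a 1, a 2, xa 0} : Finset (QuaternionGroup 2)).card = Fintype.card (QuaternionGroup 2) ∧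
    (∀ y : QuaternionGroup 2, y ≠ 1 → ∃ q, ¬ (q ∈ ({a 0, a 1, a 2, xa 0} : Finset (QuaternionGroup 2)) ↔
      y * q ∈ ({a 0, a 1, a 2, xa 0} : Finset (QuaternionGroup 2)))) ∧
    (∀ y : QuaternionGroup 2, ∃ q, (q ∈ ({a 0, a 1, a 2, xa 0} : Finset (QuaternionGroup 2)) ↔
      y * q ∈ ({a 0, a 1, a 2, xa 0} : Finset (QuaternionGroup 2)))) := by
  refine ⟨?_, by decide, by decide⟩
  rw [QuaternionGroup.card]; decide

/-- `{1, r, s, sr²} ⊂ D₄` is a balanced, aperiodic, nowhere self-complementary half. [folklore] -/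
theorem dihedralFour_half :
    2 * ({r 0, r 1, sr 0, sr 2} : Finset (DihedralGroup 4)).card = Fintype.card (DihedralGroup 4) ∧
    (∀ y : DihedralGroup 4, y ≠ 1 → ∃ q, ¬ (q ∈ ({r 0, r 1, sr 0, sr 2} : Finset (DihedralGroup 4)) ↔
      y * q ∈ ({r 0, r 1, sr 0, sr 2} : Finset (DihedralGroup 4)))) ∧
    (∀ y : DihedralGroup 4, ∃ q, (q ∈ ({r 0, r 1, sr 0, sr 2} : Finset (DihedralGroup 4)) ↔
      y * q ∈ ({r 0, r 1, sr 0, sr 2} : Finset (DihedralGroup 4)))) := by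
  refine ⟨?_, by decide, by decide⟩
  rw [DihedralGroup.card]; decide

/-- `{0, 1, 2, 4} ⊂ ℤ/8` is a balanced, aperiodic, nowhere self-complementary half. [folklore] -/
theorem cyclicEight_half :
    2 * ({Multiplicative.ofAdd (0 : ZMod 8), Multiplicative.ofAdd 1, Multiplicative.ofAdd 2,
      Multiplicative.ofAdd 4} : Finset (Multiplicative (ZMod 8))).card =
      Fintype.card (Multiplicative (ZMod 8)) ∧
    (∀ y : Multiplicative (ZMod 8), y ≠ 1 → ∃ q, ¬ (q ∈ ({Multiplicative.ofAdd (0 : ZMod 8),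
      Multiplicative.ofAdd 1, Multiplicative.ofAdd 2, Multiplicative.ofAdd 4} :
        Finset (Multiplicative (ZMod 8))) ↔
      y * q ∈ ({Multiplicative.ofAdd (0 : ZMod 8), Multiplicative.ofAdd 1, Multiplicative.ofAdd 2,
        Multiplicative.ofAdd 4} : Finset (Multiplicative (ZMod 8))))) ∧
    (∀ y : Multiplicative (ZMod 8), ∃ q, (q ∈ ({Multiplicative.ofAdd (0 : ZMod 8), Multiplicative.ofAdd 1,
      Multiplicative.ofAdd 2, Multiplicative.ofAdd 4} : Finset (Multiplicative (ZMod 8))) ↔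
      y * q ∈ ({Multiplicative.ofAdd (0 : ZMod 8), Multiplicative.ofAdd 1, Multiplicative.ofAdd 2,
        Multiplicative.ofAdd 4} : Finset (Multiplicative (ZMod 8))))) := by
  refine ⟨by decide, by decide, by decide⟩

end Halves

section Composita

open QuaternionGroup DihedralGroup

variable {K : Type} [Field K] [NumberField K] [IsCMField K] [IsGalois ℚ K]

/-- **`Gal(K/ℚ) ≅ Q₈ × Q_{4n}` (`n ≥ 1`, `c = (1, aⁿ)`) — a totally real `Q₈`-field times a `Q_{4n}`-CM field: a
SIMPLE DEGENERATE abelian variety of dimension `16n` with CM by `K`.** [cite: Shimura1998, §6.2 Thm. 3 and §8.2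
Prop. 26] [cite: Gordon1999HodgeAVSurvey, Thm. 6.4] -/
theorem exists_simple_degenerate_of_quaternion_quaternionTwo_compositum {n : ℕ} (h1 : 1 ≤ n)
    (e : (K ≃ₐ[ℚ] K) ≃* QuaternionGroup 2 × QuaternionGroup n)
    (hc : e ((IsCMField.complexConj K).restrictScalars ℚ) = (1, a n)) :
    ∃ (Φ : CMType K) (φ₀ : K →+* ℂ) (A : AbelianVariety ℂ) (ι : 𝓞 K →+* End A)
      (θ : K →+* Module.End ℂ (complexBetti A.X 1)),
      IsPrimitive (ℂ ≃+* ℂ) Φ.1 φ₀ ∧ ¬ IsNondegenerate Φ ∧ IsCMTypeRealisation Φ A ι θ ∧ A.IsSimple ∧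
      A.dim = 16 * n ∧
      ∃ n p : ℕ, ∃ x : complexBetti (⨁ fun _ : Fin n => A).X (2 * p), IsRationalClass x ∧
        IsOfHodgeType (⨁ fun _ : Fin n => A).dim (⨁ fun _ : Fin n => A).X (2 * p) p p x ∧
        x ∉ divisorClassesSpan (⨁ fun _ : Fin n => A).X (⨁ fun _ : Fin n => A).dim p := by
  obtain ⟨hcard, hprim, hcomp⟩ := quaternionTwo_half
  have hmain := exists_simple_degenerate_of_quaternion_compositum h1 e hc _ hcard hprim hcomp
  rwa [QuaternionGroup.card, show 2 * n * (4 * 2) = 16 * n by ring] at hmain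

/-- **`Gal(K/ℚ) ≅ D₄ × Q_{4n}` (`n ≥ 1`, `c = (1, aⁿ)`) — a totally real `D₄`-octic times a `Q_{4n}`-CM field: a
SIMPLE DEGENERATE abelian variety of dimension `16n` with CM by `K`.** [cite: Shimura1998, §6.2 Thm. 3 and §8.2
Prop. 26] [cite: Gordon1999HodgeAVSurvey, Thm. 6.4] -/
theorem exists_simple_degenerate_of_quaternion_dihedralFour_compositum {n : ℕ} (h1 : 1 ≤ n)
    (e : (K ≃ₐ[ℚ] K) ≃* DihedralGroup 4 × QuaternionGroup n)
    (hc : e ((IsCMField.complexConj K).restrictScalars ℚ) = (1, a n)) :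
    ∃ (Φ : CMType K) (φ₀ : K →+* ℂ) (A : AbelianVariety ℂ) (ι : 𝓞 K →+* End A)
      (θ : K →+* Module.End ℂ (complexBetti A.X 1)),
      IsPrimitive (ℂ ≃+* ℂ) Φ.1 φ₀ ∧ ¬ IsNondegenerate Φ ∧ IsCMTypeRealisation Φ A ι θ ∧ A.IsSimple ∧
      A.dim = 16 * n ∧
      ∃ n p : ℕ, ∃ x : complexBetti (⨁ fun _ : Fin n => A).X (2 * p), IsRationalClass x ∧
        IsOfHodgeType (⨁ fun _ : Fin n => A).dim (⨁ fun _ : Fin n => A).X (2 * p) p p x ∧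
        x ∉ divisorClassesSpan (⨁ fun _ : Fin n => A).X (⨁ fun _ : Fin n => A).dim p := by
  obtain ⟨hcard, hprim, hcomp⟩ := dihedralFour_half
  have hmain := exists_simple_degenerate_of_quaternion_compositum h1 e hc _ hcard hprim hcomp
  rwa [DihedralGroup.card, show 2 * n * (2 * 4) = 16 * n by ring] at hmain

/-- **`Gal(K/ℚ) ≅ C₈ × Q_{4n}` (`n ≥ 1`, `c = (0, aⁿ)`) — a real cyclic octic times a `Q_{4n}`-CM field: a SIMPLE
DEGENERATE abelian variety of dimension `16n` with CM by `K`.** [cite: Shimura1998, §6.2 Thm. 3 and §8.2 Prop. 26]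
[cite: Gordon1999HodgeAVSurvey, Thm. 6.4] -/
theorem exists_simple_degenerate_of_quaternion_cyclicEight_compositum {n : ℕ} (h1 : 1 ≤ n)
    (e : (K ≃ₐ[ℚ] K) ≃* Multiplicative (ZMod 8) × QuaternionGroup n)
    (hc : e ((IsCMField.complexConj K).restrictScalars ℚ) = (1, a n)) :
    ∃ (Φ : CMType K) (φ₀ : K →+* ℂ) (A : AbelianVariety ℂ) (ι : 𝓞 K →+* End A)
      (θ : K →+* Module.End ℂ (complexBetti A.X 1)),
      IsPrimitive (ℂ ≃+* ℂ) Φ.1 φ₀ ∧ ¬ IsNondegenerate Φ ∧ IsCMTypeRealisation Φ A ι θ ∧ A.IsSimple ∧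
      A.dim = 16 * n ∧
      ∃ n p : ℕ, ∃ x : complexBetti (⨁ fun _ : Fin n => A).X (2 * p), IsRationalClass x ∧
        IsOfHodgeType (⨁ fun _ : Fin n => A).dim (⨁ fun _ : Fin n => A).X (2 * p) p p x ∧
        x ∉ divisorClassesSpan (⨁ fun _ : Fin n => A).X (⨁ fun _ : Fin n => A).dim p := by
  obtain ⟨hcard, hprim, hcomp⟩ := cyclicEight_half
  have hmain := exists_simple_degenerate_of_quaternion_compositum h1 e hc _ hcard hprim hcomp
  rwa [Fintype.card_multiplicative, ZMod.card, show 2 * n * 8 = 16 * n by ring] at hmain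

end Composita

end Summit.HodgeConjecture.CorCM.GaloisModels
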